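import Mathlib
import HarnessLib
import Summits.HubbardSuperconductivity.HubbardSuperconductivity.Theorems.KLProgrammeC4aKernelTruncation
import Summits.HubbardSuperconductivity.HubbardSuperconductivity.Theorems.KLProgrammeC4aSecondCumulantCross
import Summits.HubbardSuperconductivity.HubbardSuperconductivity.Theorems.KLProgrammeKLRegimeWickTwoCopyKernel
import Summits.HubbardSuperconductivity.HubbardSuperconductivity.Theorems.KLProgrammeKLRegimeWickBubbleColouringsSum
import Summits.HubbardSuperconductivity.HubbardSuperconductivity.Theorems.KLProgrammeKLRegimeWickLegDressing
import Literature.MathematicalPhysics.QuantumLattice.HubbardInteractionKernels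

/-!
# Route `KLProgramme` — crux C4a, S1 (b): the 4-LEG KERNEL OF THE SECOND CUMULANT of the CT-dressed quartic w.r.t. any covariance —
# ONE-LINE TREES + ½·TWO-LINE BUBBLES, nothing else (degree bookkeeping + p1's Feynman rules)

Cell `gate-hubbard-kl`, lane hubbard-kl-c4a-1 (g5); helper for stub (C) `stub_twoLeg_curvature` of the engine-flow child `KLRegimeEngineV17F2`
(stmt-HubbardSuperconductivity-20437); memo HOME/hubbard-kl-c4a-1/C4A-PLAN.md §22.10.  `…C4aSecondCumulantCross` wrote the second cumulant as
`dblFold((e^{Δ_×} − 1)(W̃⁰W̃¹))`, `…C4aKernelTruncation` truncated `e^{Δ_×} − 1` on the low kernels; here the DEGREE hypotheses are discharged for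
`W = V_U + 𝒩_K` (kernels only in degrees `2, 4`: `kernel_hubbardInteraction_of_ne_four`, `kernel_counterQuadratic_of_ne_two`) and the two surviving terms are
p1's one-line and two-line 4-leg formulas (`kernel_dblFold_oneLine_self`, `kernel_dblFold_bubble_self`):

* §1 generic: `kernel_gaussConv_eq_zero_of_degree` (`e^{Δ_C}` does not raise the kernel degree), `kernel_copy_mul_copy_eq_zero_of_degree` (degrees add under
  `A⁰·B¹`, via p5's `norm_kernel_copy_mul_copy` / `exists_perm_block`);
* §2 model: `kernel_hubbardInteractionCT_eq_zero_of_four_lt`, `kernel_gaussConv_hubbardInteractionCT_eq_zero_of_four_lt`,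
  `kernel_twoCopy_dressed_eq_zero_of_eight_lt`;
* §3 **`kernel_four_secondCumulant_hubbardInteractionCT`**: for ANY covariance `C` and legs `Z`,
  `kernel₄(e^{Δ_C}(W·W) − e^{Δ_C}W·e^{Δ_C}W) Z = kernel₄(dblFold(Δ_×(W̃⁰W̃¹))) Z + ½·kernel₄(dblFold(Δ_×²(W̃⁰W̃¹))) Z`, `W = hubbardInteractionCT`, `W̃ = e^{Δ_C}W`,
  `Δ_× = Δ_{crossCov C}` — the two terms being p1's explicit sums (1PR trees `kernel₂W̃ ⊗ kernel₄W̃`; pp / ph-direct / ph-crossed bubbles `kernel₄W̃ ⊗ kernel₄W̃`,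
  the `𝒲₆⊗𝒲₂` term vanishing since `kernel W̃ 6 = 0`): **`kernel_four_secondCumulant_hubbardInteractionCT_explicit`**.

Exact algebra; nothing about sizes; nothing asserts superconductivity.  References: Salmhofer 1999 §2.3–2.4 [cite: Salmhofer1999]; BGM 2006 §2.2 (2.12)–(2.14)
[cite: BenfattoGiulianiMastropietro2006].
-/

noncomputable section

namespace Summit.HubbardSuperconductivity.HubbardSuperconductivity.Theorems.C4a

set_option linter.dupNamespace false -- summit = problem name (single-conjunct summit), D-0017

open Literature.MathematicalPhysics.QuantumLattice Literature.Probability.LatticeModels GrassmannAlgebra Finset Matrix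
open Summit.HubbardSuperconductivity.HubbardSuperconductivity.Theorems.KLRegimeWick
open Summit.HubbardSuperconductivity.HubbardSuperconductivity.Theorems.KLRegimeSplit
open Summit.HubbardSuperconductivity.HubbardSuperconductivity.Theorems.KLProgrammeLegKernels
open Summit.HubbardSuperconductivity.HubbardSuperconductivity.Theorems.TwoPointAssembly

/-! ## §1 Generic degree bookkeeping -/

section Generic

variable (R : Type*) [CommRing R] [Algebra ℚ R] {Γ : Type*} [Fintype Γ] [DecidableEq Γ]

omit [DecidableEq Γ] in
/-- **`e^{Δ_C}` does not raise the kernel degree**: if `W` has no kernels of degree `> d`, neither has `e^{Δ_C}W`. -/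
theorem kernel_gaussConv_eq_zero_of_degree (C : Matrix Γ Γ R) {W : GrassmannAlgebra R Γ} {d : ℕ}
    (h : ∀ j, d < j → ∀ Y : Fin j → Γ, kernel R W j Y = 0) {j : ℕ} (hj : d < j) (X : Fin j → Γ) :
    kernel R (gaussConv R C W) j X = 0 := by
  obtain ⟨k, hk⟩ := isNilpotent_grassmannLaplacian R C
  rw [gaussConv, IsNilpotent.exp_eq_sum hk, LinearMap.coe_sum, Finset.sum_apply, KLRegimeWick.kernel_finset_sum]
  refine Finset.sum_eq_zero fun i _ => ?_
  rw [LinearMap.smul_apply, kernel_ratSmul, kernel_grassmannLaplacian_pow_eq_zero_of R C i (fun j' hj' Y => h j' (by omega) Y) X, mul_zero]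

end Generic

section Norm

variable {𝕜 : Type*} [RCLike 𝕜] {Γ : Type*} [Fintype Γ] [DecidableEq Γ]

/-- **Degrees add under the two-copy product**: if `A` has no kernels of degree `> dA` and `B` none of degree `> dB`, then `A⁰·B¹` has none of degree
`> dA + dB` (each doubled label tuple sorts into a block tuple, p5's `exists_perm_block` / `norm_kernel_copy_mul_copy`). -/
theorem kernel_copy_mul_copy_eq_zero_of_degree {A B : GrassmannAlgebra 𝕜 Γ} {dA dB : ℕ}
    (hA : ∀ j, dA < j → ∀ X : Fin j → Γ, kernel 𝕜 A j X = 0) (hB : ∀ j, dB < j → ∀ Y : Fin j → Γ, kernel 𝕜 B j Y = 0)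
    {m : ℕ} (hm : dA + dB < m) (Z : Fin m → Γ × Fin 2) : kernel 𝕜 (dblCopy 𝕜 0 A * dblCopy 𝕜 1 B) m Z = 0 := by
  obtain ⟨m₀, m₁, h, σ, X, Y, hZ⟩ := exists_perm_block Z
  have hn := norm_kernel_copy_mul_copy A B Z h σ X Y hZ
  have hzero : ‖kernel 𝕜 A m₀ X‖ * ‖kernel 𝕜 B m₁ Y‖ = 0 := by
    rcases lt_or_ge dA m₀ with h0 | h0
    · rw [hA m₀ h0 X, norm_zero, zero_mul]
    · have h1 : dB < m₁ := by omega
      rw [hB m₁ h1 Y, norm_zero, mul_zero]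
  rw [hzero, mul_zero] at hn
  exact norm_eq_zero.1 hn

end Norm

/-! ## §2 The model: the CT-dressed quartic and its dressed two-copy tensor -/

section Model

variable {L M : ℕ} [NeZero L]

/-- `W = V_U + 𝒩_K` has kernels only in degrees `2` and `4`; in particular none of degree `> 4`. -/
theorem kernel_hubbardInteractionCT_eq_zero_of_four_lt (β U : ℝ) (K : TrigPolyC4v) {j : ℕ} (hj : 4 < j) (X : Fin j → HubbardFieldIdx L M) :
    kernel ℂ (hubbardInteractionCT L M β U K) j X = 0 := by
  rw [hubbardInteractionCT, kernel_add, kernel_hubbardInteraction_of_ne_four β U (by omega) X, kernel_counterQuadratic_of_ne_two β K (by omega) X,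
    add_zero]

/-- The dressed vertex `W̃ = e^{Δ_C}W` has no kernels of degree `> 4`. -/
theorem kernel_gaussConv_hubbardInteractionCT_eq_zero_of_four_lt (β U : ℝ) (K : TrigPolyC4v)
    (C : Matrix (HubbardFieldIdx L M) (HubbardFieldIdx L M) ℂ) {j : ℕ} (hj : 4 < j) (X : Fin j → HubbardFieldIdx L M) :
    kernel ℂ (gaussConv ℂ C (hubbardInteractionCT L M β U K)) j X = 0 :=
  kernel_gaussConv_eq_zero_of_degree ℂ C (fun _ hj' Y => kernel_hubbardInteractionCT_eq_zero_of_four_lt β U K hj' Y) hj X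

/-- The dressed two-copy tensor `W̃⁰·W̃¹` has no kernels of degree `> 8`. -/
theorem kernel_twoCopy_dressed_eq_zero_of_eight_lt (β U : ℝ) (K : TrigPolyC4v) (C : Matrix (HubbardFieldIdx L M) (HubbardFieldIdx L M) ℂ)
    {j : ℕ} (hj : 8 < j) (Z : Fin j → HubbardFieldIdx L M × Fin 2) :
    kernel ℂ (dblCopy ℂ 0 (gaussConv ℂ C (hubbardInteractionCT L M β U K)) * dblCopy ℂ 1 (gaussConv ℂ C (hubbardInteractionCT L M β U K))) j Z = 0 :=
  kernel_copy_mul_copy_eq_zero_of_degree (dA := 4) (dB := 4) (fun _ hj' X => kernel_gaussConv_hubbardInteractionCT_eq_zero_of_four_lt β U K C hj' X)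
    (fun _ hj' Y => kernel_gaussConv_hubbardInteractionCT_eq_zero_of_four_lt β U K C hj' Y) (by omega) Z

/-! ## §3 The 4-leg kernel of the second cumulant -/

/-- **The 4-leg kernel of the second cumulant of `W = V_U + 𝒩_K` w.r.t. ANY covariance `C`**: with `W̃ = e^{Δ_C}W`, `Δ_× = Δ_{crossCov C}`,
`kernel₄(e^{Δ_C}(W·W) − e^{Δ_C}W·e^{Δ_C}W) Z = kernel₄(dblFold(Δ_×(W̃⁰W̃¹))) Z + ½·kernel₄(dblFold(Δ_×(Δ_×(W̃⁰W̃¹)))) Z` — one-line trees plus half the two-line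
bubbles; the `≥ 3`-line terms do not reach degree four. [cite: Salmhofer1999, §2.4] -/
theorem kernel_four_secondCumulant_hubbardInteractionCT (β U : ℝ) (K : TrigPolyC4v) (C : Matrix (HubbardFieldIdx L M) (HubbardFieldIdx L M) ℂ)
    (Z : Fin 4 → HubbardFieldIdx L M) :
    kernel ℂ (gaussConv ℂ C (hubbardInteractionCT L M β U K * hubbardInteractionCT L M β U K) -
        gaussConv ℂ C (hubbardInteractionCT L M β U K) * gaussConv ℂ C (hubbardInteractionCT L M β U K)) 4 Z =
      kernel ℂ (dblFold ℂ (grassmannLaplacian ℂ (crossCov ℂ C)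
          (dblCopy ℂ 0 (gaussConv ℂ C (hubbardInteractionCT L M β U K)) * dblCopy ℂ 1 (gaussConv ℂ C (hubbardInteractionCT L M β U K))))) 4 Z +
        ((2 : ℚ)⁻¹ • (1 : ℂ)) * kernel ℂ (dblFold ℂ (grassmannLaplacian ℂ (crossCov ℂ C) (grassmannLaplacian ℂ (crossCov ℂ C)
          (dblCopy ℂ 0 (gaussConv ℂ C (hubbardInteractionCT L M β U K)) * dblCopy ℂ 1 (gaussConv ℂ C (hubbardInteractionCT L M β U K)))))) 4 Z := by
  rw [secondCumulant_eq_dblFold_cross ℂ C (hubbardInteractionCT_mem_evenOdd_zero L M β U K)]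
  exact kernel_dblFold_gaussConv_sub_self_eq ℂ (crossCov ℂ C) (fun j hj Y => kernel_twoCopy_dressed_eq_zero_of_eight_lt β U K C (by omega) Y) Z

/-- **The same, EXPLICIT** (p1's Feynman rules plugged in; `W̃ = e^{Δ_C}(V_U + 𝒩_K)`, `Δ_× = Δ_{crossCov C}`): the one-line term is
`4·(−T₀ + T₁ − T₂ + T₃)`, `Tᵢ = Σ_{X,Y} contr C X Y·kernel W̃ 2 (X,Zᵢ)·kernel W̃ 4 (Y, Z∖Zᵢ)` (1PR trees: Hartree tadpole / counterterm insertions), the two-line term is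
`−2·4!·(B(Z₂Z₃|Z₀Z₁) + B(Z₀Z₃|Z₁Z₂) − B(Z₀Z₂|Z₁Z₃))` (pp, ph-direct, ph-crossed bubbles, `B(A|B) = Σ contr C X Y·contr C X′Y′·kernel W̃ 4 (X,X′,A)·kernel W̃ 4 (Y,Y′,B)`);
the `𝒲₆⊗𝒲₂` term of `kernel_dblFold_bubble_self` vanishes (`kernel W̃ 6 = 0`). -/
theorem kernel_four_secondCumulant_hubbardInteractionCT_explicit (β U : ℝ) (K : TrigPolyC4v) (C : Matrix (HubbardFieldIdx L M) (HubbardFieldIdx L M) ℂ)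
    (Z : Fin 4 → HubbardFieldIdx L M) :
    kernel ℂ (gaussConv ℂ C (hubbardInteractionCT L M β U K * hubbardInteractionCT L M β U K) -
        gaussConv ℂ C (hubbardInteractionCT L M β U K) * gaussConv ℂ C (hubbardInteractionCT L M β U K)) 4 Z =
      4 * (-(∑ X, ∑ Y, contr ℂ C X Y * (kernel ℂ (gaussConv ℂ C (hubbardInteractionCT L M β U K)) 2 ![X, Z 0] *
              kernel ℂ (gaussConv ℂ C (hubbardInteractionCT L M β U K)) 4 ![Y, Z 1, Z 2, Z 3])) +
            (∑ X, ∑ Y, contr ℂ C X Y * (kernel ℂ (gaussConv ℂ C (hubbardInteractionCT L M β U K)) 2 ![X, Z 1] *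
              kernel ℂ (gaussConv ℂ C (hubbardInteractionCT L M β U K)) 4 ![Y, Z 0, Z 2, Z 3])) -
            (∑ X, ∑ Y, contr ℂ C X Y * (kernel ℂ (gaussConv ℂ C (hubbardInteractionCT L M β U K)) 2 ![X, Z 2] *
              kernel ℂ (gaussConv ℂ C (hubbardInteractionCT L M β U K)) 4 ![Y, Z 0, Z 1, Z 3])) +
            (∑ X, ∑ Y, contr ℂ C X Y * (kernel ℂ (gaussConv ℂ C (hubbardInteractionCT L M β U K)) 2 ![X, Z 3] *
              kernel ℂ (gaussConv ℂ C (hubbardInteractionCT L M β U K)) 4 ![Y, Z 0, Z 1, Z 2]))) +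
        ((2 : ℚ)⁻¹ • (1 : ℂ)) *
          -(2 * (Nat.factorial 4 : ℂ) *
            ((∑ X, ∑ Y, ∑ X', ∑ Y', contr ℂ C X Y * contr ℂ C X' Y' *
                (kernel ℂ (gaussConv ℂ C (hubbardInteractionCT L M β U K)) 4 ![X, X', Z 2, Z 3] *
                  kernel ℂ (gaussConv ℂ C (hubbardInteractionCT L M β U K)) 4 ![Y, Y', Z 0, Z 1])) +
              (∑ X, ∑ Y, ∑ X', ∑ Y', contr ℂ C X Y * contr ℂ C X' Y' *
                (kernel ℂ (gaussConv ℂ C (hubbardInteractionCT L M β U K)) 4 ![X, X', Z 0, Z 3] *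
                  kernel ℂ (gaussConv ℂ C (hubbardInteractionCT L M β U K)) 4 ![Y, Y', Z 1, Z 2])) -
              (∑ X, ∑ Y, ∑ X', ∑ Y', contr ℂ C X Y * contr ℂ C X' Y' *
                (kernel ℂ (gaussConv ℂ C (hubbardInteractionCT L M β U K)) 4 ![X, X', Z 0, Z 2] *
                  kernel ℂ (gaussConv ℂ C (hubbardInteractionCT L M β U K)) 4 ![Y, Y', Z 1, Z 3])))) := by
  have hWt : gaussConv ℂ C (hubbardInteractionCT L M β U K) ∈ evenOdd ℂ 0 := gaussConv_mem_evenOdd ℂ C (hubbardInteractionCT_mem_evenOdd_zero L M β U K)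
  have h6 : ∀ Y : Fin 6 → HubbardFieldIdx L M, kernel ℂ (gaussConv ℂ C (hubbardInteractionCT L M β U K)) 6 Y = 0 := fun Y =>
    kernel_gaussConv_hubbardInteractionCT_eq_zero_of_four_lt β U K C (by norm_num) Y
  rw [kernel_four_secondCumulant_hubbardInteractionCT, kernel_dblFold_oneLine_self ℂ C hWt Z, kernel_dblFold_bubble_self ℂ C C hWt Z]
  simp only [h6, zero_mul, mul_zero, Finset.sum_const_zero, sub_zero]

end Model

end Summit.HubbardSuperconductivity.HubbardSuperconductivity.Theorems.C4a

end
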